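import Mathlib
import Summits.ValiantsHypothesis.ValiantsHypothesis.Theorems.NewtonUnitEquationsTwoProductsConfinedTameLawDefs
import Summits.ValiantsHypothesis.ValiantsHypothesis.Theorems.TwoProducts.Negative.TowerPaddingResidual
import HarnessLib

/-!
# NEGATIVE lane (val-neg-1 g5): the residual after rung R10, BY NAME over the landed `R10Defs`

Helper file for crux `stmt-ValiantsHypothesis-5906` (filed `--supports`; closes NO item, proves NO summit statement, does NOT prove
`TwoProducts`, `PlanarCellBound`, any `ResidualLawV…`, `ConfinedTameLaw` or VP ≠ VNP; 0 `def`s).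

By-name restatement of `Negative/TowerPaddingResidual.planarCellBound_of_residualNotTame` / `residualNotTame_iff_planarCellBound`
(p654184) over val-lit-p3 g16's landed `Theorems/NewtonUnitEquationsTwoProductsConfinedTameLawDefs.lean` (`R10Defs.LetterConfined`,
`R10Defs.FibreSpread`; texts = val-idea-37's `Sketch.lean`, which p654184 unfolds token-for-token, so the proofs are definitional):
for every fixed `C`, the law «hypotheses of `relation_ladder` v21′ ∧ no letter set `L` with `#L ≤ C·m` that is `LetterConfined` and has
`FibreSpread ≤ (m+2)^C` ⟹ cell bound» is EQUIVALENT to `PlanarCellBound`.  Together with p3 g16's `R10.confinedTameLaw_holds (C)` (the rung,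
all `C`): the residual of the ladder after R10 is the full per-cell law again.  [folklore]
-/

namespace Summit.ValiantsHypothesis.Theorems.TwoProducts.Negative.TowerPaddingR10

open Finset MvPolynomial
open Summit.ValiantsHypothesis.ValiantsHypothesis.Theorems.NewtonUnitEquations.TwoProducts.FormalLogLinearisation
open Summit.ValiantsHypothesis.ValiantsHypothesis.Theorems.NewtonUnitEquations.TwoProducts.PlanarCell
open Summit.ValiantsHypothesis.ValiantsHypothesis.Theorems.NewtonUnitEquations.TwoProducts.PermutationType
open Summit.ValiantsHypothesis.Theorems.TwoProducts.Negative.TowerPaddingResidual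

/-- **The post-R10 residual law implies `PlanarCellBound`** (by name over `R10Defs`; exponents as in p654184:
`(a, b) ↦ (a(18C+27), b + a(2(576C+608) + 18(C+1)(C+36)))`). [folklore] -/
theorem planarCellBound_of_residualNotTameR10 (C : ℕ)
    (h : ∃ a b : ℕ, ∀ (m t : ℕ), 2 ≤ t → ∀ (u v : Fin m → MvPolynomial (Fin 2) ℂ),
      (∀ j, coeff 0 (u j) = 0 ∧ (u j).support.card ≤ t) → (∀ j, coeff 0 (v j) = 0 ∧ (v j).support.card ≤ t) →
      (∀ (J : Finset (Fin m)) (j₀ : Fin m), j₀ ∈ J →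
        BlockSmall (fun j => (u j).support ∪ (v j).support) J (2 ^ m * (t + 2) ^ 4) →
        ¬ PermType (mergeA (fun j => (u j).support ∪ (v j).support) J j₀)) →
      (∀ (r : ℕ) (Jc : Fin r → Finset (Fin m)) (ac bc : Fin r → Fin m → Expo),
        (∀ a ∈ tuples (fun j => (u j).support ∪ (v j).support), ∀ b ∈ tuples (fun j => (u j).support ∪ (v j).support),
          a ≠ b → ∑ j, a j = ∑ j, b j →
          ∃ k : Fin r, (∀ j, a j ≠ b j ↔ j ∈ Jc k) ∧
            ((∀ j ∈ Jc k, a j = ac k j ∧ b j = bc k j) ∨ (∀ j ∈ Jc k, a j = bc k j ∧ b j = ac k j))) →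
        2 ^ m * (t + 2) ^ 4 < 2 * (m + 1) * (3 * (2 + m + m.choose 2) ^ 2) ^ r) →
      (¬ ∃ ρp ρm : Expo →₀ ℕ, RankOneCoincidences (fun j => (u j).support ∪ (v j).support) ρp ρm) →
      (∀ L : Finset Expo, L.card ≤ C * m →
        R10Defs.LetterConfined (fun j => (u j).support ∪ (v j).support) L →
        ¬ R10Defs.FibreSpread (fun j => (u j).support ∪ (v j).support) L ((m + 2) ^ C)) →
      ∀ (R : Expo → Expo → Prop) (S : Finset Expo), IsCellFamily u v R S → S.card ≤ 2 ^ (a * m) * (t + 2) ^ b) :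
    ∃ a b : ℕ, ∀ (m t : ℕ), 2 ≤ t → ∀ (u v : Fin m → MvPolynomial (Fin 2) ℂ),
      (∀ j, coeff 0 (u j) = 0 ∧ (u j).support.card ≤ t) → (∀ j, coeff 0 (v j) = 0 ∧ (v j).support.card ≤ t) →
      ∀ (R : Expo → Expo → Prop) (S : Finset Expo),
        (∀ l ∈ S, ∃ ξ : Fin 2 → ℝ, ValidWeight u v ξ ∧ IsStrictTop ξ (logSupport u v) l ∧
          ∀ e ∈ ((Finset.univ.biUnion fun j => (u j).support) ∪ Finset.univ.biUnion fun j => (v j).support),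
          ∀ e' ∈ ((Finset.univ.biUnion fun j => (u j).support) ∪ Finset.univ.biUnion fun j => (v j).support),
            (R e e' ↔ wt ξ e ≤ wt ξ e')) →
        S.card ≤ 2 ^ (a * m) * (t + 2) ^ b :=
  planarCellBound_of_residualNotTame C h

/-- **Post-R10 residual law ⇔ `PlanarCellBound`** (by name over `R10Defs`). [folklore] -/
theorem residualNotTameR10_iff_planarCellBound (C : ℕ) :
    (∃ a b : ℕ, ∀ (m t : ℕ), 2 ≤ t → ∀ (u v : Fin m → MvPolynomial (Fin 2) ℂ),
      (∀ j, coeff 0 (u j) = 0 ∧ (u j).support.card ≤ t) → (∀ j, coeff 0 (v j) = 0 ∧ (v j).support.card ≤ t) →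
      (∀ (J : Finset (Fin m)) (j₀ : Fin m), j₀ ∈ J →
        BlockSmall (fun j => (u j).support ∪ (v j).support) J (2 ^ m * (t + 2) ^ 4) →
        ¬ PermType (mergeA (fun j => (u j).support ∪ (v j).support) J j₀)) →
      (∀ (r : ℕ) (Jc : Fin r → Finset (Fin m)) (ac bc : Fin r → Fin m → Expo),
        (∀ a ∈ tuples (fun j => (u j).support ∪ (v j).support), ∀ b ∈ tuples (fun j => (u j).support ∪ (v j).support),
          a ≠ b → ∑ j, a j = ∑ j, b j →
          ∃ k : Fin r, (∀ j, a j ≠ b j ↔ j ∈ Jc k) ∧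
            ((∀ j ∈ Jc k, a j = ac k j ∧ b j = bc k j) ∨ (∀ j ∈ Jc k, a j = bc k j ∧ b j = ac k j))) →
        2 ^ m * (t + 2) ^ 4 < 2 * (m + 1) * (3 * (2 + m + m.choose 2) ^ 2) ^ r) →
      (¬ ∃ ρp ρm : Expo →₀ ℕ, RankOneCoincidences (fun j => (u j).support ∪ (v j).support) ρp ρm) →
      (∀ L : Finset Expo, L.card ≤ C * m →
        R10Defs.LetterConfined (fun j => (u j).support ∪ (v j).support) L →
        ¬ R10Defs.FibreSpread (fun j => (u j).support ∪ (v j).support) L ((m + 2) ^ C)) →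
      ∀ (R : Expo → Expo → Prop) (S : Finset Expo), IsCellFamily u v R S → S.card ≤ 2 ^ (a * m) * (t + 2) ^ b) ↔
    ∃ a b : ℕ, ∀ (m t : ℕ), 2 ≤ t → ∀ (u v : Fin m → MvPolynomial (Fin 2) ℂ),
      (∀ j, coeff 0 (u j) = 0 ∧ (u j).support.card ≤ t) → (∀ j, coeff 0 (v j) = 0 ∧ (v j).support.card ≤ t) →
      ∀ (R : Expo → Expo → Prop) (S : Finset Expo),
        (∀ l ∈ S, ∃ ξ : Fin 2 → ℝ, ValidWeight u v ξ ∧ IsStrictTop ξ (logSupport u v) l ∧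
          ∀ e ∈ ((Finset.univ.biUnion fun j => (u j).support) ∪ Finset.univ.biUnion fun j => (v j).support),
          ∀ e' ∈ ((Finset.univ.biUnion fun j => (u j).support) ∪ Finset.univ.biUnion fun j => (v j).support),
            (R e e' ↔ wt ξ e ≤ wt ξ e')) →
        S.card ≤ 2 ^ (a * m) * (t + 2) ^ b :=
  ⟨planarCellBound_of_residualNotTameR10 C, fun ⟨a, b, h⟩ => ⟨a, b, fun m t ht u v hu hv _ _ _ _ R S hS => h m t ht u v hu hv R S hS⟩⟩

end Summit.ValiantsHypothesis.Theorems.TwoProducts.Negative.TowerPaddingR10
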